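import Summits.Ventures.PercRepro.RankLevelSetRuleQStaircaseMapsB
import Summits.Ventures.PercRepro.RankLevelSetRuleQSliceThreeWitnessTen
import Summits.Ventures.PercRepro.RankLevelSetRuleQSliceFourWitnessTen
import Summits.Ventures.PercRepro.RankLevelSetRuleQSliceFiveWitnessTen
import Summits.Ventures.PercRepro.RankLevelSetRuleQSliceSixWitnessTen
import Summits.Ventures.PercRepro.RankLevelSetRuleQSliceSevenWitnessTen

/-!
# PercRepro — THE EXACT THIN-SLICE MAP OF THE FAMILY `k = 10` UP TO `u = 10`, AND THE UNIFORM STATEMENT FOR `k = 5 … 10`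
(night-1, gen 18 → 19; dossier §29.8, §30.8)

With the staircase up to `u = 10` (`rhat_staircase_ten`), the borderline slice `rhat_ten_slice_eight_all`, the ends and the kernel
negatives — the slice `u = 2` for every `k ≥ 5` (`rhat_lt_phiK_of_five_le`) and the night-1 witnesses `rhat_lt_phiK_176_10_173`,
`rhat_lt_phiK_88_10_84`, `rhat_lt_phiK_97_10_92`, `rhat_lt_phiK_192_10_186`, `rhat_lt_phiK_695_10_688` (`u = 3 … 7` at `k = 10`):
* **`rhat_ten_slice_iff`** — a slice `u ≤ 10` of the family `k = 10` is paid on every cell `(q+10, q)` iff `u ∉ {2, 3, 4, 5, 6, 7}`;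
* **`rhat_thin_slice_iff`** — UNIFORMLY: for `5 ≤ k ≤ 10` and `u ≤ 10`, the slice `u = q − #P` is paid by Rule Q's equal split
  on EVERY cell `(q+k, q)` iff `u ∉ [2, k − 3]` (the families `k ≤ 9` from RankLevelSetRuleQStaircaseMapsB).
Axioms: standard.
-/

namespace PercRepro

open Finset

/-- **The slices `u ≤ 10` of the family `k = 10`, exactly**: paid on EVERY cell `(q+10, q)` iff `u ∉ {2, 3, 4, 5, 6, 7}`. -/
theorem rhat_ten_slice_iff (u : ℕ) (hu10 : u ≤ 10) :
    (∀ q, u ≤ q → phiK (q + 10) q ≤ rhat q 10 (q - u)) ↔ (u ≠ 2 ∧ u ≠ 3 ∧ u ≠ 4 ∧ u ≠ 5 ∧ u ≠ 6 ∧ u ≠ 7) := by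
  constructor
  · intro h
    refine ⟨fun hu2 => ?_, fun hu3 => ?_, fun hu4 => ?_, fun hu5 => ?_, fun hu6 => ?_, fun hu7 => ?_⟩
    · subst hu2
      have h1 := h (4 ^ (10 + 3) + 2) (by norm_num)
      have h2 := rhat_lt_phiK_of_five_le 10 (by norm_num) (4 ^ (10 + 3)) le_rfl
      rw [show 4 ^ (10 + 3) + 2 - 2 = 4 ^ (10 + 3) by omega] at h1
      exact absurd (lt_of_lt_of_le h2 h1) (lt_irrefl _)
    · subst hu3
      have h1 := h 176 (by norm_num)
      have h2 := rhat_lt_phiK_176_10_173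
      rw [show (176 : ℕ) - 3 = 173 by norm_num] at h1
      exact absurd (lt_of_lt_of_le h2 h1) (lt_irrefl _)
    · subst hu4
      have h1 := h 88 (by norm_num)
      have h2 := rhat_lt_phiK_88_10_84
      rw [show (88 : ℕ) - 4 = 84 by norm_num] at h1
      exact absurd (lt_of_lt_of_le h2 h1) (lt_irrefl _)
    · subst hu5
      have h1 := h 97 (by norm_num)
      have h2 := rhat_lt_phiK_97_10_92
      rw [show (97 : ℕ) - 5 = 92 by norm_num] at h1
      exact absurd (lt_of_lt_of_le h2 h1) (lt_irrefl _)
    · subst hu6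
      have h1 := h 192 (by norm_num)
      have h2 := rhat_lt_phiK_192_10_186
      rw [show (192 : ℕ) - 6 = 186 by norm_num] at h1
      exact absurd (lt_of_lt_of_le h2 h1) (lt_irrefl _)
    · subst hu7
      have h1 := h 695 (by norm_num)
      have h2 := rhat_lt_phiK_695_10_688
      rw [show (695 : ℕ) - 7 = 688 by norm_num] at h1
      exact absurd (lt_of_lt_of_le h2 h1) (lt_irrefl _)
  · rintro ⟨hu2, hu3, hu4, hu5, hu6, hu7⟩ q hq
    rcases Nat.lt_or_ge u 9 with hlt | hge
    · interval_cases u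
      · rw [Nat.sub_zero]; exact rhatCell_self q 10 (by norm_num)
      · exact rhatCell_pred q 10 hq (by norm_num)
      · exact absurd rfl hu2
      · exact absurd rfl hu3
      · exact absurd rfl hu4
      · exact absurd rfl hu5
      · exact absurd rfl hu6
      · exact absurd rfl hu7
      · exact rhat_ten_slice_eight_all q hq
    · exact rhat_staircase_ten 10 u q (by norm_num) (by norm_num) (by omega) hu10 hq

/-- **THE THIN-SLICE MAP OF EVERY FAMILY `k = 5 … 10`, EXACTLY, UP TO `u = 10`**: Rule Q's equal split pays the slice
`u = q − #P` on EVERY cell `(q+k, q)` if and only if `u ∉ [2, k − 3]` — the slices `u ≤ 1`, the borderline `u = k − 2` and the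
untruncated `k − 1 ≤ u ≤ 10` are paid on every cell, the slices `2 ≤ u ≤ k − 3` each fail on some cell. -/
theorem rhat_thin_slice_iff (k u : ℕ) (hk5 : 5 ≤ k) (hk10 : k ≤ 10) (hu10 : u ≤ 10) :
    (∀ q, u ≤ q → phiK (q + k) q ≤ rhat q k (q - u)) ↔ (u < 2 ∨ k - 2 ≤ u) := by
  rcases Nat.lt_or_ge k 10 with hlt | hge
  · exact rhat_thin_slice_iff_nine k u hk5 (by omega) hu10
  · have hk : k = 10 := by omega
    subst hk
    rw [rhat_ten_slice_iff u hu10]; omega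

end PercRepro
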